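import Summits.AtomisticToContinuum.Crystallization.Theorems.ShellsToBarlowChart.Negative.Tolerance
import Summits.AtomisticToContinuum.Crystallization.Theorems.PalmUnimodularRigidityShellsToBarlowChartDefs
import Summits.AtomisticToContinuum.Crystallization.Theorems.PalmUnimodularRigidityShellsToBarlowChartCubicGrowthAngle
import Literature.MeasureTheory.Covering.VolumePacking

/-!
# Cubic volume growth of the window graph of an every-point-good set

Stub `stub_cubicGrowth` of line `develop-the-model-growth-descent` (crux `ShellsToBarlowChart`,
stmt-AtomisticToContinuum-9227): if every point of `S ⊆ ℝ³` has a `1 %`-good FCC/HCP shell at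
its own scale `a ∈ [9/10, 1]`, then the ball of radius `n` about `x ∈ S` in the window (bond)
graph has at least `(n/6)³` points.

Proof.  SHELL FACTS (`shellAt`): at `x ∈ S` with scale `a`, every point of `S` within `5a/4`
of `x` is a perturbed pattern point, at distance in `[0.99a, 1.01a]` (so bonded to `x`, and the
hard core `0.891` follows), and — by the `45°` covering angle of both patterns — for every
direction `d` some neighbour `y` has `⟪y − x, d⟫ ≥ 0.697·a·‖d‖`.  GREEDY STEPS
(`exists_step`): stepping from `x` to that neighbour towards a target `z` at distance `r` gives
`dist(y, z)² ≤ r² − 1.394·a·r + 1.0201·a²`, which is `≤ (r − 1/3)²` for `r ≥ 3/2`,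
`≤ (9/8)²` for `r ≤ 3/2` (and `9/8 ≤ 5a_z/4`, so `y` is then bonded to `z`), and
`≤ r² − 1/20` for `r ≥ 4/5`.  Hence every `z ∈ S` with `dist(x, z) ≤ 3/2 + m/3` is joined to
`x` by a walk of length `≤ m + 2` (`exists_walk`), and every point of space is within `4/5` of
`S` (`exists_near`).  COUNTING: `S` is `0.89`-separated, so its bounded parts are finite
(packing bound), the window ball of radius `n` lies in `B(x, 28n/25)` and is finite, it
contains `S ∩ B(x, R)`, `R = 3/2 + (n−2)/3`, and the balls `B(y, 4/5)`, `y ∈ S ∩ B(x, R)`, cover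
`B(x, R − 4/5)`, whence `#(S ∩ B(x,R)) ≥ ((R − 4/5)/(4/5))³ ≥ (n/6)³` by volume.
-/

noncomputable section

namespace Summit.AtomisticToContinuum.Crystallization.Theorems.PalmUnimodularRigidityShellsToBarlowChart

open Literature.Geometry.DiscreteGeometry Literature.MathematicalPhysics.StatisticalMechanics
open Summit.AtomisticToContinuum.Crystallization.Theorems.ShellsToBarlowChartNegative
open MeasureTheory Metric
open scoped ENNReal NNReal

/-- Euclidean `3`-space. -/
local notation "E3" => EuclideanSpace ℝ (Fin 3)

/-! ## Shell facts -/

/-- **Shell facts at a good point.**  If `x` has a `1 %`-good shell at scale `a ∈ [9/10, 1]`,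
then every `y ∈ S`, `y ≠ x`, within `5a/4` of `x` is at distance in `[0.99a, 1.01a]`, and for
every vector `d` some such `y` has `⟪y − x, d⟫ ≥ 0.697·a·‖d‖` (the `45°` covering angle of the
pattern, up to the `1 %` matching error). [folklore] -/
theorem shellAt {S : Set E3} {x : E3} (h : GoodShellAt (9 / 10) 1 S x) :
    ∃ a : ℝ, 9 / 10 ≤ a ∧ a ≤ 1 ∧
      (∀ y ∈ S, y ≠ x → dist y x ≤ 5 / 4 * a →
          99 / 100 * a ≤ dist y x ∧ dist y x ≤ 101 / 100 * a) ∧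
      (∀ d : E3, ∃ y ∈ S, y ≠ x ∧ dist y x ≤ 5 / 4 * a ∧
          697 / 1000 * a * ‖d‖ ≤ inner ℝ (y - x) d) := by
  obtain ⟨a, ha9, ha1, T, hT, hclose⟩ := h
  -- uniformise the two patterns: unit vectors with covering angle `45°`
  obtain ⟨P, hP1, hPcov, A, e, he⟩ : ∃ P : Finset E3, (∀ v ∈ P, ‖v‖ = 1) ∧
      (∀ u : E3, ∃ v ∈ P, ‖u‖ ≤ Real.sqrt 2 * inner ℝ u v) ∧
      ∃ A : E3 →ₗᵢ[ℝ] E3, ∃ e : ↥T ≃ ↥((P.image fun v : E3 => a • v).image A),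
        ∀ t : ↥T, dist (t : E3) (e t) ≤ a / 100 := by
    rcases hclose with ⟨A, e, he⟩ | ⟨A, e, he⟩
    · exact ⟨fccKissingPattern, fun v hv => norm_eq_one_of_mem_fccKissingPattern hv,
        fcc_coveringAngle, A, e, he⟩
    · exact ⟨hcpKissingPattern, fun v hv => norm_eq_one_of_mem_hcpKissingPattern hv,
        hcp_coveringAngle, A, e, he⟩
  have ha0 : 0 < a := by linarith
  have hnormq : ∀ q ∈ (P.image fun v : E3 => a • v).image A, ‖q‖ = a := by
    intro q hq
    obtain ⟨p, hp, rfl⟩ := Finset.mem_image.1 hq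
    obtain ⟨v, hv, rfl⟩ := Finset.mem_image.1 hp
    rw [LinearIsometry.norm_map, norm_smul, Real.norm_of_nonneg ha0.le, hP1 v hv, mul_one]
  have hmemT : ∀ y ∈ S, y ≠ x → dist y x ≤ 5 / 4 * a → y - x ∈ T := by
    intro y hy hne hd
    have : y - x ∈ (↑T : Set E3) := by rw [hT]; exact ⟨y, ⟨hy, hne, hd⟩, rfl⟩
    exact this
  have hTmem : ∀ t ∈ T, ∃ y ∈ S, y ≠ x ∧ dist y x ≤ 5 / 4 * a ∧ y - x = t := by
    intro t ht
    have ht' : t ∈ (↑T : Set E3) := ht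
    rw [hT] at ht'
    obtain ⟨y, ⟨hy, hne, hd⟩, rfl⟩ := ht'
    exact ⟨y, hy, hne, hd, rfl⟩
  refine ⟨a, ha9, ha1, ?_, ?_⟩
  · intro y hy hne hd
    have ht := hmemT y hy hne hd
    have h1 := he ⟨y - x, ht⟩
    have hq := hnormq _ (e ⟨y - x, ht⟩).2
    have htri := abs_norm_sub_norm_le (y - x) (e ⟨y - x, ht⟩ : E3)
    rw [hq, ← dist_eq_norm (y - x)] at htri
    rw [dist_eq_norm]
    have h2 := htri.trans h1
    rw [abs_le] at h2
    constructor <;> linarith [h2.1, h2.2]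
  · intro d
    -- a preimage direction `d'` with `A d' = d`
    obtain ⟨d', hd'⟩ : ∃ d' : E3, A d' = d :=
      ⟨(A.toLinearIsometryEquiv rfl).symm d, by
        rw [← LinearIsometry.coe_toLinearIsometryEquiv A rfl]
        exact (A.toLinearIsometryEquiv rfl).apply_symm_apply d⟩
    have hnd : ‖d'‖ = ‖d‖ := by rw [← hd', LinearIsometry.norm_map]
    obtain ⟨v, hv, hcov⟩ := hPcov d'
    have hq : A (a • v) ∈ (P.image fun v : E3 => a • v).image A :=
      Finset.mem_image_of_mem _ (Finset.mem_image_of_mem _ hv)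
    obtain ⟨t, ht⟩ : ∃ t : ↥T, e t = ⟨A (a • v), hq⟩ := ⟨e.symm _, e.apply_symm_apply _⟩
    obtain ⟨y, hy, hne, hd, hyt⟩ := hTmem (t : E3) t.2
    refine ⟨y, hy, hne, hd, ?_⟩
    have h1 : dist (t : E3) (A (a • v)) ≤ a / 100 := by
      have := he t
      rwa [ht] at this
    -- the inner product of the ideal point
    have hinner : inner ℝ (A (a • v)) d = a * inner ℝ d' v := by
      rw [← hd', LinearIsometry.inner_map_map, real_inner_smul_left, real_inner_comm]
    -- `⟪d', v⟫ ≥ ‖d‖/√2 ≥ 0.707 ‖d‖`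
    have hI0 : 0 ≤ inner ℝ d' v :=
      (mul_nonneg_iff_of_pos_left (by positivity)).1 ((norm_nonneg d').trans hcov)
    have hI : 707 / 1000 * ‖d‖ ≤ inner ℝ d' v := by
      have h2 : ‖d'‖ ≤ 14143 / 10000 * inner ℝ d' v :=
        hcov.trans (mul_le_mul_of_nonneg_right sqrt_two_lt'.le hI0)
      rw [hnd] at h2
      linarith
    -- the matching error
    have herr : |inner ℝ ((t : E3) - A (a • v)) d| ≤ a / 100 * ‖d‖ := by
      refine (abs_real_inner_le_norm _ _).trans ?_
      rw [← dist_eq_norm]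
      exact mul_le_mul_of_nonneg_right h1 (norm_nonneg _)
    have hsplit :
        inner ℝ (t : E3) d = inner ℝ (A (a • v)) d + inner ℝ ((t : E3) - A (a • v)) d := by
      rw [inner_sub_left]; ring
    rw [hyt, hsplit, hinner]
    rw [abs_le] at herr
    nlinarith [mul_le_mul_of_nonneg_left hI ha0.le, herr.1, norm_nonneg d]

/-- **Hard-core / bond dichotomy made adjacency**: two distinct points of an every-point-good
set at distance `≤ 9/8` are bonded (the second is a shell point of the first:
`9/8 ≤ 5a/4`, so the distance is `≤ 1.01a ≤ 28/25`). [folklore] -/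
theorem adj_of_dist_le {S : Set E3} (hS : GoodShells S) {y z : E3} (hy : y ∈ S) (hz : z ∈ S)
    (hne : y ≠ z) (hd : dist y z ≤ 9 / 8) : (windowGraph S).Adj y z := by
  obtain ⟨a, ha9, ha1, hshell, -⟩ := shellAt (hS z hz)
  obtain ⟨-, hhi⟩ := hshell y hy hne (by linarith)
  rw [windowGraph, SimpleGraph.fromRel_adj]
  exact ⟨hne, Or.inl ⟨hy, hz, dist_pos.2 hne, by linarith⟩⟩

/-- **Hard core**: distinct points of an every-point-good set are `≥ 0.891` apart. [folklore] -/
theorem hardCore {S : Set E3} (hS : GoodShells S) {y z : E3} (hy : y ∈ S) (hz : z ∈ S)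
    (hne : y ≠ z) : 891 / 1000 ≤ dist y z := by
  obtain ⟨a, ha9, -, hshell, -⟩ := shellAt (hS z hz)
  by_cases hd : dist y z ≤ 5 / 4 * a
  · obtain ⟨hlo, -⟩ := hshell y hy hne hd
    linarith
  · push Not at hd
    linarith

/-! ## Greedy steps -/

/-- **The greedy step.**  From `x ∈ S` towards any target `z` there is a bonded neighbour `y`
with `dist(y, z)² ≤ dist(x, z)² − 1.394·a·dist(x, z) + 1.0201·a²` for the scale `a ∈ [9/10, 1]`
of `x`. [folklore] -/
theorem exists_step {S : Set E3} (hS : GoodShells S) {x : E3} (hx : x ∈ S) (z : E3) :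
    ∃ y ∈ S, (windowGraph S).Adj x y ∧ ∃ a : ℝ, 9 / 10 ≤ a ∧ a ≤ 1 ∧
      dist y z ^ 2 ≤ dist x z ^ 2 - 1394 / 1000 * a * dist x z + 10201 / 10000 * a ^ 2 := by
  obtain ⟨a, ha9, ha1, hshell, hdir⟩ := shellAt (hS x hx)
  obtain ⟨y, hy, hne, hd, hinner⟩ := hdir (z - x)
  obtain ⟨hlo, hhi⟩ := hshell y hy hne hd
  refine ⟨y, hy, ?_, a, ha9, ha1, ?_⟩
  · rw [windowGraph, SimpleGraph.fromRel_adj]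
    refine ⟨fun h => hne h.symm, Or.inl ⟨hx, hy, ?_, ?_⟩⟩
    · exact dist_pos.2 fun h => hne h.symm
    · rw [dist_comm]; linarith
  · have key : dist y z ^ 2 = ‖y - x‖ ^ 2 - 2 * inner ℝ (y - x) (z - x) + ‖z - x‖ ^ 2 := by
      rw [dist_eq_norm, ← norm_sub_sq_real, sub_sub_sub_cancel_right]
    have h1 : ‖y - x‖ ≤ 101 / 100 * a := by rwa [← dist_eq_norm]
    have h2 : ‖z - x‖ = dist x z := by rw [dist_comm, dist_eq_norm]
    rw [key, h2]
    rw [h2] at hinner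
    nlinarith [mul_le_mul h1 h1 (norm_nonneg _) (by positivity), norm_nonneg (y - x)]

/-- Far from the target (`r ≥ 3/2`) a greedy step gains `1/3`. [folklore] -/
theorem step_far {r a : ℝ} (ha9 : 9 / 10 ≤ a) (ha1 : a ≤ 1) (hr : 3 / 2 ≤ r) :
    r ^ 2 - 1394 / 1000 * a * r + 10201 / 10000 * a ^ 2 ≤ (r - 1 / 3) ^ 2 := by
  nlinarith [mul_nonneg (sub_nonneg.2 hr) (sub_nonneg.2 ha9),
    mul_nonneg (sub_nonneg.2 ha9) (sub_nonneg.2 ha1)]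

/-- Near the target (`r ≤ 3/2`) a greedy step lands within `9/8`. [folklore] -/
theorem step_near {r a : ℝ} (ha9 : 9 / 10 ≤ a) (ha1 : a ≤ 1) (hr0 : 0 ≤ r) (hr : r ≤ 3 / 2) :
    r ^ 2 - 1394 / 1000 * a * r + 10201 / 10000 * a ^ 2 ≤ (9 / 8) ^ 2 := by
  nlinarith [mul_nonneg hr0 (sub_nonneg.2 hr), mul_nonneg (sub_nonneg.2 ha9) (sub_nonneg.2 ha1),
    mul_nonneg (sub_nonneg.2 hr) (sub_nonneg.2 ha1), mul_nonneg hr0 (sub_nonneg.2 ha9)]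

/-- At distance `≥ 4/5` from the target a greedy step decreases the squared distance by `1/20`.
[folklore] -/
theorem step_cover {r a : ℝ} (ha9 : 9 / 10 ≤ a) (ha1 : a ≤ 1) (hr : 4 / 5 ≤ r) :
    r ^ 2 - 1394 / 1000 * a * r + 10201 / 10000 * a ^ 2 ≤ r ^ 2 - 1 / 20 := by
  nlinarith [mul_nonneg (sub_nonneg.2 hr) (sub_nonneg.2 ha9),
    mul_nonneg (sub_nonneg.2 ha9) (sub_nonneg.2 ha1)]

/-- **Greedy walks.**  Every `x ∈ S` with `dist(x, z) ≤ 3/2 + m/3`, `z ∈ S`, is joined to `z`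
by a walk of length `≤ m + 2` in the window graph. [folklore] -/
theorem exists_walk {S : Set E3} (hS : GoodShells S) {z : E3} (hz : z ∈ S) :
    ∀ m : ℕ, ∀ x ∈ S, dist x z ≤ 3 / 2 + (m : ℝ) / 3 →
      ∃ w : (windowGraph S).Walk x z, w.length ≤ m + 2 := by
  intro m
  induction m with
  | zero =>
    intro x hx hd
    by_cases hxz : x = z
    · subst hxz
      exact ⟨SimpleGraph.Walk.nil, by simp⟩
    obtain ⟨y, hy, hadj, a, ha9, ha1, hest⟩ := exists_step hS hx z
    have hyz : dist y z ≤ 9 / 8 := by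
      have h2 : dist y z ^ 2 ≤ (9 / 8) ^ 2 :=
        hest.trans (step_near ha9 ha1 dist_nonneg (by simpa using hd))
      exact (abs_le_of_sq_le_sq' h2 (by norm_num)).2
    by_cases hyz' : y = z
    · subst hyz'
      exact ⟨SimpleGraph.Walk.cons hadj SimpleGraph.Walk.nil, by simp⟩
    · exact ⟨SimpleGraph.Walk.cons hadj
        (SimpleGraph.Walk.cons (adj_of_dist_le hS hy hz hyz' hyz) SimpleGraph.Walk.nil), by simp⟩
  | succ m ih =>
    intro x hx hd
    by_cases hle : dist x z ≤ 3 / 2 + (m : ℝ) / 3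
    · obtain ⟨w, hw⟩ := ih x hx hle
      exact ⟨w, by omega⟩
    push Not at hle
    obtain ⟨y, hy, hadj, a, ha9, ha1, hest⟩ := exists_step hS hx z
    have h32 : 3 / 2 ≤ dist x z := by
      have : (0 : ℝ) ≤ (m : ℝ) / 3 := by positivity
      linarith
    have h2 : dist y z ^ 2 ≤ (dist x z - 1 / 3) ^ 2 := hest.trans (step_far ha9 ha1 h32)
    have hyz : dist y z ≤ dist x z - 1 / 3 := (abs_le_of_sq_le_sq' h2 (by linarith)).2
    have hyz' : dist y z ≤ 3 / 2 + (m : ℝ) / 3 := by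
      push_cast at hd
      linarith
    obtain ⟨w, hw⟩ := ih y hy hyz'
    exact ⟨SimpleGraph.Walk.cons hadj w, by rw [SimpleGraph.Walk.length_cons]; omega⟩

/-- **Covering radius `< 4/5`** (greedy descent of the squared distance by `1/20` per step).
[folklore] -/
theorem exists_near_aux {S : Set E3} (hS : GoodShells S) (p : E3) :
    ∀ m : ℕ, ∀ c ∈ S, dist c p ^ 2 ≤ (m : ℝ) / 20 → ∃ y ∈ S, dist y p < 4 / 5 := by
  intro m
  induction m with
  | zero =>
    intro c hc hd
    refine ⟨c, hc, ?_⟩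
    have : dist c p ^ 2 ≤ 0 := by simpa using hd
    nlinarith [dist_nonneg (x := c) (y := p)]
  | succ m ih =>
    intro c hc hd
    by_cases hlt : dist c p < 4 / 5
    · exact ⟨c, hc, hlt⟩
    push Not at hlt
    obtain ⟨y, hy, -, a, ha9, ha1, hest⟩ := exists_step hS hc p
    have := step_cover ha9 ha1 hlt
    refine ih y hy ?_
    push_cast at hd
    linarith

/-- **Covering radius `< 4/5`**: every point of space is within `4/5` of a nonempty
every-point-good set. [folklore] -/
theorem exists_near {S : Set E3} (hS : GoodShells S) {x : E3} (hx : x ∈ S) (p : E3) :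
    ∃ y ∈ S, dist y p < 4 / 5 :=
  exists_near_aux hS p ⌈20 * dist x p ^ 2⌉₊ x hx
    (by have := Nat.le_ceil (20 * dist x p ^ 2); linarith)

/-! ## Finiteness and counting -/

/-- Walks in the window graph stay in `S` and have short steps: the endpoint of a walk of
length `ℓ` from a point of `S` is in `S`, within `28ℓ/25`. [folklore] -/
theorem walk_mem_and_dist {S : Set E3} {u v : E3} (w : (windowGraph S).Walk u v) (hu : u ∈ S) :
    v ∈ S ∧ dist u v ≤ 28 / 25 * w.length := by
  induction w with
  | nil => simp [hu]
  | @cons a b c h w ih =>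
    obtain ⟨-, h'⟩ := (SimpleGraph.fromRel_adj _ _ _).1 h
    have hb : b ∈ S ∧ dist a b ≤ 28 / 25 := by
      rcases h' with ⟨-, h2, -, h4⟩ | ⟨h1, -, -, h4⟩
      · exact ⟨h2, h4⟩
      · exact ⟨h1, by rw [dist_comm]; exact h4⟩
    obtain ⟨hmem, hdist⟩ := ih hb.1
    refine ⟨hmem, ?_⟩
    rw [SimpleGraph.Walk.length_cons]
    push_cast
    linarith [dist_triangle a b c]

/-- **Bounded parts of an every-point-good set are finite** (it is `0.89`-separated: packing
bound). [folklore] -/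
theorem finite_inter_closedBall {S : Set E3} (hS : GoodShells S) (x : E3) (R : ℝ) :
    (S ∩ closedBall x R).Finite := by
  have hsep : Metric.IsSeparated ((89 / 100 : ℝ≥0) : ℝ≥0∞) (S ∩ closedBall x R) := by
    intro y hy z hz hne
    have hd := hardCore hS hy.1 hz.1 hne
    rw [edist_dist, ← ENNReal.ofReal_coe_nnreal]
    refine (ENNReal.ofReal_lt_ofReal_iff (dist_pos.2 hne)).2 ?_
    push_cast
    linarith
  have hfin : volume (⋃ a ∈ S ∩ closedBall x R, ball a (((89 / 100 : ℝ≥0) : ℝ) / 2)) ≠ ⊤ := by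
    refine (lt_of_le_of_lt (measure_mono ?_) (measure_ball_lt_top (x := x) (r := R + 1))).ne
    intro p hp
    obtain ⟨a, ha, hpa⟩ := Set.mem_iUnion₂.1 hp
    rw [mem_ball] at hpa ⊢
    have h1 : dist a x ≤ R := mem_closedBall.1 ha.2
    have h2 : (((89 / 100 : ℝ≥0) : ℝ) / 2) ≤ 1 := by push_cast; norm_num
    linarith [dist_triangle p a x]
  have hpack := Metric.packingNumber_ne_top_of_measure_ne_top volume (by norm_num) hfin
  have hle := Metric.IsSeparated.encard_le_packingNumber subset_rfl hsep
  exact Set.encard_ne_top_iff.1 (ne_top_of_le_ne_top hpack hle)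

/-- **Volume count.**  For `x ∈ S` and `R ≥ 4/5`, the set `S ∩ B(x, R)` has at least
`((R − 4/5)/(4/5))³` points: the balls `B(y, 4/5)` about its points cover `B(x, R − 4/5)`.
[folklore] -/
theorem cube_le_ncard {S : Set E3} (hS : GoodShells S) {x : E3} (hx : x ∈ S) {R : ℝ}
    (hR : 4 / 5 ≤ R) :
    ((R - 4 / 5) / (4 / 5)) ^ 3 ≤ (Set.ncard (S ∩ closedBall x R) : ℝ) := by
  have hF := finite_inter_closedBall hS x R
  have hcov : closedBall x (R - 4 / 5) ⊆ ⋃ y ∈ hF.toFinset, closedBall y (4 / 5) := by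
    intro p hp
    obtain ⟨y, hy, hyp⟩ := exists_near hS hx p
    have hyF : y ∈ hF.toFinset := by
      rw [Set.Finite.mem_toFinset]
      refine ⟨hy, mem_closedBall.2 ?_⟩
      have := mem_closedBall.1 hp
      linarith [dist_triangle y p x]
    exact Set.mem_biUnion hyF (mem_closedBall'.2 hyp.le)
  have hvol : volume (closedBall x (R - 4 / 5)) ≤
      ∑ y ∈ hF.toFinset, volume (closedBall y (4 / 5 : ℝ)) :=
    (measure_mono hcov).trans (measure_biUnion_finset_le _ _)
  rw [Measure.addHaar_closedBall volume x (by linarith : (0 : ℝ) ≤ R - 4 / 5),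
    Finset.sum_congr rfl (fun y _ =>
      Measure.addHaar_closedBall volume y (by norm_num : (0 : ℝ) ≤ 4 / 5)),
    Finset.sum_const, nsmul_eq_mul, finrank_euclideanSpace_fin, ← mul_assoc] at hvol
  have hV0 : volume (ball (0 : E3) 1) ≠ 0 := (measure_ball_pos volume (0 : E3) one_pos).ne'
  have hVt : volume (ball (0 : E3) 1) ≠ ⊤ := measure_ball_lt_top.ne
  rw [ENNReal.mul_le_mul_iff_left hV0 hVt, ← ENNReal.ofReal_natCast,
    ← ENNReal.ofReal_mul (by positivity), ENNReal.ofReal_le_ofReal_iff (by positivity)] at hvol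
  rw [Set.ncard_eq_toFinset_card _ hF, div_pow, div_le_iff₀ (by positivity)]
  exact hvol

/-! ## The stub -/

/-- **Cubic growth of the window graph.**  If every point of `S` has a `1 %`-good shell, the
ball of radius `n ≥ 12` about `x ∈ S` in the window graph has at least `(n/6)³` points.
[folklore] -/
theorem stub_cubicGrowth :
    ∀ S : Set E3, GoodShells S → ∀ x ∈ S, ∀ n : ℕ, 12 ≤ n →
      ((n : ℝ) / 6) ^ 3 ≤ (Set.ncard (windowBall S x n) : ℝ) := by
  intro S hS x hx n hn
  -- the metric ball of radius `R = 3/2 + (n-2)/3` lies in the window ball of radius `n`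
  have hsub : S ∩ closedBall x (3 / 2 + ((n - 2 : ℕ) : ℝ) / 3) ⊆ windowBall S x n := by
    rintro y ⟨hy, hyR⟩
    rw [mem_closedBall, dist_comm] at hyR
    obtain ⟨w, hw⟩ := exists_walk hS hy (n - 2) x hx hyR
    exact ⟨w, by omega⟩
  -- the window ball is finite
  have hWfin : (windowBall S x n).Finite := by
    refine (finite_inter_closedBall hS x (28 / 25 * n)).subset ?_
    rintro y ⟨w, hw⟩
    obtain ⟨hyS, hd⟩ := walk_mem_and_dist w hx
    refine ⟨hyS, mem_closedBall.2 ?_⟩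
    rw [dist_comm]
    have : (w.length : ℝ) ≤ n := by exact_mod_cast hw
    linarith
  have hR : (4 : ℝ) / 5 ≤ 3 / 2 + ((n - 2 : ℕ) : ℝ) / 3 := by
    have : (0 : ℝ) ≤ ((n - 2 : ℕ) : ℝ) / 3 := by positivity
    linarith
  have hcount := cube_le_ncard hS hx hR
  have hmono : (Set.ncard (S ∩ closedBall x (3 / 2 + ((n - 2 : ℕ) : ℝ) / 3)) : ℝ) ≤
      Set.ncard (windowBall S x n) := by
    exact_mod_cast Set.ncard_le_ncard hsub hWfin
  refine le_trans ?_ (hcount.trans hmono)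
  have hn0 : (12 : ℝ) ≤ n := by exact_mod_cast hn
  rw [Nat.cast_sub (by omega : 2 ≤ n)]
  push_cast
  have h1 : (n : ℝ) / 6 ≤ (3 / 2 + ((n : ℝ) - 2) / 3 - 4 / 5) / (4 / 5) := by linarith
  exact pow_le_pow_left₀ (by positivity) h1 3

end Summit.AtomisticToContinuum.Crystallization.Theorems.PalmUnimodularRigidityShellsToBarlowChart

end
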